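/-
Copyright (c) 2026. Released under the Apache 2.0 license.
-/
import Literature.NumberTheory.EllipticCurves.ModularCurve
import Literature.NumberTheory.EllipticCurves.QuadraticTwist
import Literature.NumberTheory.EllipticCurves.GlobalMinimalModel
import Literature.NumberTheory.DiophantineGeometry.Conductor
import HarnessLib

/-!
# Minimal discriminants of the quadratic twist by `−1` when both curves are additive at `2`
# (Connell, *Elliptic Curve Handbook* 5.7.3, in the corrected form of Pal 2012, Prop. 2.4)

The source. V. Pal, *Periods of quadratic twists of elliptic curves* (with an appendix by A. Agashe), Proc.
AMS 140 (2012) 1513–1525 (bib key `Pal2012`; held: `paper:arxiv-1012.0094`, p. 4), **Proposition 2.4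
(Connell)**, verbatim frame: "Recall that `E` is a minimal elliptic curve over `ℚ` and `E^d` is its quadratic
twist by a square-free integer `d`. Let `Δ` be the discriminant of `E`, let `Δ′` be the discriminant of
`E^d_min` … Then: • If `p` is an odd prime divisor of `d` then [±6]. If `p` is an odd prime not dividing `d`,
then `v_p(Δ′) = v_p(Δ)`. • If `p = 2` then: – If `d ≡ 1 mod 4`, then `v₂(Δ′) = v₂(Δ)`. – If `d ≡ 3 mod 4`,
then (i) if the 2-adic signature of `E` is `0,0,c` (`c ≥ 0`) or `a,3,0` (`4 ≤ a ≤ ∞`), then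
`v₂(Δ′) = v₂(Δ) + 12`; (ii) if the 2-adic signature of `E` is `4,6,c` (`c ≥ 12` and `2⁻⁶c₆(E)d ≡ −1 mod 4`)
or `a,9,12` (`a ≥ 8` and `2⁻⁹c₆(E)d ≡ 1 mod 4`), then `v₂(Δ′) = v₂(Δ) − 12`; (iii) otherwise
`v₂(Δ′) = v₂(Δ)`. – If `d ≡ 2 mod 4` …" ("This proposition is the corrected form of [Connell 5.7.3], which is
misstated in Connell's book. The proof given by Connell is however correct.")  Here the 2-adic signature of
`E` is `(v₂(c₄(E)), v₂(c₆(E)), v₂(Δ(E)))`.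

## What is transcribed, and how (cell `bsd-f2-manin`, T-an-8; refuter-2 R-an-15 verdict «covered by the printed
## items + elementary globalisation», 2026-08-27T19:56Z)

ONE named fact, the GLOBAL COROLLARY of Prop. 2.4 at `d = −1` for curves ADDITIVE AT `2` on both sides, in the
tree's vocabulary (globally minimal `WeierstrassCurve ℚ` models, `conductorNorm`, `quadraticTwist`, the
`VariableChange` action): if `W` and `W′` are globally minimal, `2² ∣ N(W)`, `2² ∣ N(W′)` and `W′ ≅ W ⊗ (−1)`
over `ℚ` (`u • W.quadraticTwist (−1) = W′`), then `Δ(W′) = Δ(W)`.  DERIVATION from the printed per-prime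
statement (three lines, recorded so the reviewer can check faithfulness): (a) `p = 2`, `d = −1 ≡ 3 (mod 4)`: case
(i) has `E` semistable at `2` (signature `0,0,c` = `c₄` a 2-unit: good or multiplicative; `a,3,0` = `v₂(Δ) = 0`:
good), excluded by `2² ∣ N(W)`; case (ii) would give `v₂(Δ) = v₂(Δ′) + 12`, i.e. Prop. 2.4 applied to the minimal
curve `E′ = E^d_min` (whose twist by `−1` is `E`) is in case (i), so `E′` is semistable at `2`, excluded by
`2² ∣ N(W′)`; hence case (iii): `v₂(Δ′) = v₂(Δ)`.  (b) odd `p`: `p ∤ d = −1`, so `v_p(Δ′) = v_p(Δ)`.  (c) sign and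
assembly: `Δ(W ⊗ (−1)) = (−1)⁶Δ(W)` (Pal Remark 2.3) and a `ℚ`-isomorphism rescales `Δ` by `u⁻¹²`, so `Δ(W′)/Δ(W)`
is a positive rational with all `p`-adic valuations `0`, i.e. `1`.  `TODO(general form)`: the full per-prime table
of Prop. 2.4 (all square-free `d`), which needs the tree's 2-adic signature ↔ reduction-type bridge for minimal
models to be consumable.

Consumer: the cell's kernel-checked `Summit.BirchSwinnertonDyer.Rank1Residual.ManinAdditive.minusOneOrbitManinEq_of_pal`
/ `minusOneTwistRigidity_of_pal` (T-an-7 file 5, `NegOneOptimalTwistRigidityProof.lean`), whose hypothesis schema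
`NegOneTwistMinimalDiscrEq` is literally this statement: THEOREM I of the cell (`MinusOneOrbitManinEq`: on every
same-level `χ₋₄`-orbit with `2⁵ ∣ N` the optimal curves are `ℚ`-isomorphic twists with `c′ = ±c`) then holds
CONDITIONALLY on this single printed input.  BC5 check of the statement itself (Cremona `N < 5·10⁵`, `2⁵ ∣ N`):
`Δ′ = Δ` on 148 277 / 148 277 same-level `χ₋₄` orbits (cell HOME/MEMO-an.md §40).

## References
* [Pal2012] op. cit., Prop. 2.4 (Connell) p. 4, Remark 2.3, Prop. 2.5.
* [Connell1999] I. Connell, *Elliptic Curve Handbook* (1999), §5.7.3.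
-/

noncomputable section

namespace Literature.NumberTheory.EllipticCurves

open _root_.WeierstrassCurve

/-- **Connell–Pal: the minimal discriminant is unchanged by the `−1`-twist when both curves are additive at
`2`.**  For globally minimal `W`, `W′` over `ℚ` with `2² ∣ N(W)`, `2² ∣ N(W′)` and `u • (W ⊗ (−1)) = W′` for some
`ℚ`-isomorphism `u`: `Δ(W′) = Δ(W)`.  Global corollary (derivation (a)–(c) in the module docstring) of the printed
per-prime statement: at `p = 2`, `d ≡ 3 (mod 4)`, case (iii) `v₂(Δ′) = v₂(Δ)` — cases (i)/(ii) have one side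
semistable at `2`; at odd `p ∤ d`, `v_p(Δ′) = v_p(Δ)`; the sign is `(−1)⁶ = 1`.
[cite: Pal2012, Prop. 2.4 (Connell), case p = 2, d ≡ 3 (mod 4) (iii), and «p odd, p ∤ d»; Remark 2.3]
[cite: Connell1999, §5.7.3] -/
def connellPal_Δ_eq_of_negOne_twist_of_four_dvd_conductor : Prop :=
  ∀ (W W' : WeierstrassCurve ℚ) [W.IsElliptic] [W.IsGloballyMinimal] [W'.IsElliptic]
    [W'.IsGloballyMinimal] (u : VariableChange ℚ),
    2 ^ 2 ∣ W.conductorNorm ℤ → 2 ^ 2 ∣ W'.conductorNorm ℤ →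
    u • W.quadraticTwist ((-1 : ℤ) : ℚ) = W' → W'.Δ = W.Δ

end Literature.NumberTheory.EllipticCurves
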